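import Mathlib.Analysis.SpecialFunctions.Pow.Integral
import Mathlib.Analysis.InnerProductSpace.Dual
import Literature.Analysis.FluidPDE.KatoSymmetryCovariance
import Literature.Analysis.FluidPDE.KatoViscosityScaling
import Literature.Analysis.FluidPDE.RusinSverakCompactnessProofs
import Literature.Analysis.FluidPDE.MildSolutionsProofs
import HarnessLib

/-!
# Weak `Ḣ^{1/2}` limits of represented data: pairings, reality, divergence-freeness

Analysis/FluidPDE support file, definitions-free (serves the named facts around
`Literature.Analysis.FluidPDE.rusin_sverak_minimal_data_compact`, `RusinSverakCompactness.lean` /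
`RusinSverakCompactnessProofs.lean`, which transcribe Rusin–Šverák, J. Funct. Anal. 260 (2011)
= arXiv:0911.0500, Cor. 4.3).

In the proof of Cor. 4.3 (arXiv p. 8) Rusin–Šverák pass to a weak `Ḣ^{1/2}` limit of a bounded
sequence of initial data: "We can assume that the functions `v₀^k` converge weakly in `Ḣ^{1/2}`
to `v₀ ∈ Ḣ^{1/2}`", and then use `v₀` as an initial datum (real, divergence free). In the tree a
datum is an `L³` field `u₀ : ℝ³ → ℝ³` *represented* by a Fourier-side class
`g ∈ HomSobolev ℝ³ ℂ³ (1/2) = L²(‖ξ‖ dξ; ℂ³)` (`HomSobolev.Represents`: `∫ 𝓕φ • u₀ = ∫ φ • g`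
for all Schwartz `φ`). This file **proves** the bookkeeping behind that sentence:

* `HomSobolev.lintegral_enorm_sq_mul_inv_enorm_lt_top`: `𝓢(ℝ³) ⊂ Ḣ^{-1/2}(ℝ³)`, i.e.
  `∫ |φ(ξ)|² ‖ξ‖⁻¹ dξ < ∞` (`‖ξ‖⁻¹` is integrable near `0` in dimension `3 > 1`, Mathlib
  `integrableOn_ball_of_norm_le_rpow`); hence (`HomSobolev.lintegral_enorm_smul_le`) the pairing
  `g ↦ ∫ φ • g` is bounded on `Ḣ^{1/2} = L²(‖ξ‖ dξ)` by Cauchy–Schwarz, and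
  (`HomSobolev.tendsto_inner_integral_smul_toLp`) weak convergence `gₙ ⇀ g` in the Hilbert space
  `Ḣ^{1/2}` implies convergence of the pairings `∫ φ • gₙ → ∫ φ • g` (Fréchet–Riesz, Mathlib
  `InnerProductSpace.toDual`) — Bahouri–Chemin–Danchin 2011, Prop. 1.34/1.36: `Ḣ^s ⊂ 𝓢'`
  continuously for `s < d/2`;
* `HomSobolev.Represents.tendsto_inner_integral_smul`: consequently the represented fields
  converge in `𝓢'`: `∫ ψ • uₙ → ∫ ψ • u` componentwise for every Schwartz `ψ`;
* `HomSobolev.Represents.im_apply_ae_eq_zero`, `HomSobolev.Represents.exists_real_divFree`: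
  a weak `Ḣ^{1/2}` limit of classes representing *real, weakly divergence-free* fields, if it is
  represented by an `L³` field at all, is represented by a real, weakly divergence-free `L³`
  field (reality and `div = 0` are closed under convergence in `𝓢'`; Mathlib
  `ae_eq_zero_of_integral_contDiff_smul_eq_zero`);
* `HomSobolev.exists_represents_memLp_three`: every class `g ∈ Ḣ^{1/2}(ℝ³)` is represented by
  an `L³` function, granted the tree's Sobolev-embedding fact
  `eLpNorm_three_le_eHomSobolevSeminorm_half` (Bahouri–Chemin–Danchin 2011, Thm. 1.38), by
  truncation on the Fourier side, Plancherel, and completeness of `L³` (Parseval between `L²`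
  and `𝓢` is `HomSobolev.integral_fourier_smul_eq_integral_smul_fourier_Lp` of
  `MildSolutionsProofs.lean`).

## Mathlib / tree search

Mathlib: `MeasureTheory.Lp.fourierTransformₗᵢ` (Plancherel), `Lp.fourier_toTemperedDistribution_eq`,
`Lp.toTemperedDistribution_apply`, `integrableOn_ball_of_norm_le_rpow`,
`ENNReal.lintegral_mul_le_Lp_mul_Lq`, `InnerProductSpace.toDual`,
`ae_eq_zero_of_integral_contDiff_smul_eq_zero`, `HasCompactSupport.toSchwartzMap`,
`EuclideanSpace.inner_single_left`, `integral_ofReal`, `integral_im`. Tree: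
`HomSobolev.Represents` (`MildSolutions.lean`), `HomSobolev.represents_ofFun_holds`,
`HomSobolev.integral_fourier_smul_eq_integral_smul_fourier_Lp` (`MildSolutionsProofs.lean`),
`HomSobolev.Represents.unique`,
`volume_absolutelyContinuous_homSobolevMeasure` (`KatoViscosityScaling.lean`),
`HomSobolevSymmetry.homSobolevMeasure_half_eq` (`RusinSverakCompactnessProofs.lean`),
`Fluid.real_inner_gradient_right` (`SelfSimilarProofs.lean`), `Fluid.IsWeaklyDivFree`.

## References

* W. Rusin, V. Šverák, *Minimal initial data for potential Navier–Stokes singularities*,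
  J. Funct. Anal. 260 (2011) 879–891 = arXiv:0911.0500, proof of Cor. 4.3 (p. 8), Thm. 4.2
  (p. 7: weak limits of initial data).
* H. Bahouri, J.-Y. Chemin, R. Danchin, *Fourier Analysis and Nonlinear PDE* (2011), Def. 1.31,
  Prop. 1.34, Prop. 1.36 (`Ḣ^s ↪ 𝓢'` for `s < d/2`; duality `Ḣ^{-s} = (Ḣ^s)'`).
-/

noncomputable section

open MeasureTheory TopologicalSpace Filter Topology Set Function FourierTransform
open scoped ENNReal NNReal InnerProductSpace SchwartzMap ComplexConjugate

namespace Literature.Analysis.FluidPDE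

section HomSobolev
open Literature.Analysis.FunctionSpaces (HomSobolev)
open Literature.Analysis.FunctionSpaces.HomSobolev

/-! ## `Represents` and a.e. modifications -/

section General

variable {E F : Type*} [NormedAddCommGroup E] [InnerProductSpace ℝ E] [FiniteDimensional ℝ E]
  [MeasurableSpace E] [BorelSpace E] [NormedAddCommGroup F] [InnerProductSpace ℂ F]
  [CompleteSpace F]

omit [CompleteSpace F] in
/-- `Represents` only depends on the `volume`-a.e. class of the represented function (both the
integrability of `𝓕φ • f` and the pairing `∫ 𝓕φ • f` are a.e.-invariant). [folklore] -/
theorem _root_.Literature.Analysis.FunctionSpaces.HomSobolev.Represents.congr_ae {s : ℝ} {g : HomSobolev E F s} {f f' : E → F} (h : g.Represents f)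
    (hff' : f =ᵐ[volume] f') : g.Represents f' := by
  have hae : ∀ φ : 𝓢(E, ℂ), (fun x => (𝓕 φ) x • f x) =ᵐ[volume] fun x => (𝓕 φ) x • f' x :=
    fun φ => hff'.mono fun x hx => by
      show (𝓕 φ) x • f x = (𝓕 φ) x • f' x
      rw [hx]
  refine ⟨fun φ => (h.1 φ).congr (hae φ), h.2.1, fun φ => ?_⟩
  rw [← integral_congr_ae (hae φ)]
  exact h.2.2 φ

end General

/-! ## `𝓢(ℝ³) ⊂ Ḣ^{-1/2}(ℝ³)`: boundedness of the pairing on `Ḣ^{1/2}(ℝ³)` -/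

section Half

variable {F : Type*} [NormedAddCommGroup F] [InnerProductSpace ℂ F]

/-- `‖ξ‖⁻¹` is integrable on balls of `ℝ³` (`1 < 3 = dim`; Mathlib
`integrableOn_ball_of_norm_le_rpow`). [folklore] -/
theorem _root_.Literature.Analysis.FunctionSpaces.HomSobolev.lintegral_ball_inv_enorm_lt_top (R : ℝ) :
    ∫⁻ ξ in Metric.ball (0 : EuclideanSpace ℝ (Fin 3)) R, ‖ξ‖ₑ⁻¹ < ∞ := by
  have hint : IntegrableOn (fun ξ : EuclideanSpace ℝ (Fin 3) => ‖ξ‖⁻¹) (Metric.ball 0 R) volume := by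
    refine integrableOn_ball_of_norm_le_rpow (by rw [finrank_euclideanSpace_fin]; norm_num)
      (C := 1) (α := 1) (by rw [finrank_euclideanSpace_fin]; norm_num)
      (Eventually.of_forall fun ξ => ?_) measurable_norm.inv.aestronglyMeasurable
    rw [norm_inv, norm_norm, Real.rpow_neg_one, one_mul]
  have h : ∫⁻ ξ in Metric.ball (0 : EuclideanSpace ℝ (Fin 3)) R, ‖(‖ξ‖⁻¹ : ℝ)‖ₑ < ∞ := hint.2
  refine lt_of_le_of_lt (lintegral_mono_ae ?_) h
  have h0 : ∀ᵐ ξ ∂(volume : Measure (EuclideanSpace ℝ (Fin 3))), ξ ≠ 0 := by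
    rw [ae_iff]; simp [measure_singleton]
  filter_upwards [ae_restrict_of_ae h0] with ξ hξ
  rw [Real.enorm_eq_ofReal (inv_nonneg.2 (norm_nonneg ξ)),
    ENNReal.ofReal_inv_of_pos (norm_pos_iff.2 hξ), ofReal_norm]

/-- **`𝓢(ℝ³) ⊂ Ḣ^{-1/2}(ℝ³)`**: `∫ |φ(ξ)|² ‖ξ‖⁻¹ dξ < ∞` for every Schwartz `φ` (bounded near
the integrable singularity `‖ξ‖⁻¹`, and `|φ|² ∈ L¹` away from it; Bahouri–Chemin–Danchin 2011,
Prop. 1.36 with `s = -1/2`, `|s| < 3/2`). [cite: BahouriCheminDanchin2011, Prop. 1.36] -/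
theorem _root_.Literature.Analysis.FunctionSpaces.HomSobolev.lintegral_enorm_sq_mul_inv_enorm_lt_top (φ : 𝓢(EuclideanSpace ℝ (Fin 3), ℂ)) :
    ∫⁻ ξ, ‖φ ξ‖ₑ ^ 2 * ‖ξ‖ₑ⁻¹ < ∞ := by
  rw [← lintegral_add_compl _
    (measurableSet_ball : MeasurableSet (Metric.ball (0 : EuclideanSpace ℝ (Fin 3)) 1))]
  refine ENNReal.add_lt_top.2 ⟨?_, ?_⟩
  · set C := SchwartzMap.seminorm ℂ 0 0 φ with hC
    have hle : ∀ ξ, ‖φ ξ‖ₑ ^ 2 * ‖ξ‖ₑ⁻¹ ≤ ENNReal.ofReal C ^ 2 * ‖ξ‖ₑ⁻¹ := fun ξ => by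
      gcongr
      rw [← ofReal_norm]
      exact ENNReal.ofReal_le_ofReal (SchwartzMap.norm_le_seminorm ℂ φ ξ)
    calc ∫⁻ ξ in Metric.ball 0 1, ‖φ ξ‖ₑ ^ 2 * ‖ξ‖ₑ⁻¹
        ≤ ∫⁻ ξ in Metric.ball 0 1, ENNReal.ofReal C ^ 2 * ‖ξ‖ₑ⁻¹ := lintegral_mono fun ξ => hle ξ
      _ = ENNReal.ofReal C ^ 2 * ∫⁻ ξ in Metric.ball 0 1, ‖ξ‖ₑ⁻¹ :=
          lintegral_const_mul' _ _ (ENNReal.pow_ne_top ENNReal.ofReal_ne_top)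
      _ < ∞ := ENNReal.mul_lt_top (ENNReal.pow_lt_top ENNReal.ofReal_lt_top)
          (lintegral_ball_inv_enorm_lt_top 1)
  · have h2 := lintegral_rpow_enorm_lt_top_of_eLpNorm_lt_top two_ne_zero ENNReal.ofNat_ne_top
      (φ.memLp 2 (volume : Measure (EuclideanSpace ℝ (Fin 3)))).eLpNorm_lt_top
    simp only [ENNReal.toReal_ofNat, ENNReal.rpow_ofNat] at h2
    refine lt_of_le_of_lt ?_ h2
    calc ∫⁻ ξ in (Metric.ball 0 1)ᶜ, ‖φ ξ‖ₑ ^ 2 * ‖ξ‖ₑ⁻¹ ≤ ∫⁻ ξ in (Metric.ball 0 1)ᶜ, ‖φ ξ‖ₑ ^ 2 := by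
          refine setLIntegral_mono' measurableSet_ball.compl fun ξ hξ => ?_
          have h1 : 1 ≤ ‖ξ‖ₑ := by
            rw [← ofReal_norm, ← ENNReal.ofReal_one]
            exact ENNReal.ofReal_le_ofReal (by simpa using hξ)
          calc ‖φ ξ‖ₑ ^ 2 * ‖ξ‖ₑ⁻¹ ≤ ‖φ ξ‖ₑ ^ 2 * 1 := by
                gcongr
                exact ENNReal.inv_le_one.2 h1
            _ = ‖φ ξ‖ₑ ^ 2 := mul_one _
      _ ≤ ∫⁻ ξ, ‖φ ξ‖ₑ ^ 2 := setLIntegral_le_lintegral _ _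

/-- **Boundedness of the pairing `g ↦ ∫ φ • g` on `Ḣ^{1/2}(ℝ³) = L²(‖ξ‖ dξ)`** (Cauchy–Schwarz in
`L²(‖ξ‖ dξ)` after writing `φ = (φ ‖ξ‖⁻¹) · ‖ξ‖`):
`∫ ‖φ(ξ) • G(ξ)‖ dξ ≤ (∫ |φ|² ‖ξ‖⁻¹ dξ)^{1/2} ‖G‖_{L²(‖ξ‖dξ)}` (Bahouri–Chemin–Danchin 2011,
Prop. 1.36: `|⟨u, φ⟩| ≤ ‖u‖_{Ḣ^s} ‖φ‖_{Ḣ^{-s}}`). [cite: BahouriCheminDanchin2011, Prop. 1.36] -/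
theorem _root_.Literature.Analysis.FunctionSpaces.HomSobolev.lintegral_enorm_smul_le (φ : 𝓢(EuclideanSpace ℝ (Fin 3), ℂ)) {G : EuclideanSpace ℝ (Fin 3) → F}
    (hG : AEStronglyMeasurable G (FunctionSpaces.homSobolevMeasure (EuclideanSpace ℝ (Fin 3)) (1 / 2 : ℝ))) :
    ∫⁻ ξ, ‖φ ξ • G ξ‖ₑ ≤ (∫⁻ ξ, ‖φ ξ‖ₑ ^ 2 * ‖ξ‖ₑ⁻¹) ^ (1 / 2 : ℝ) *
      eLpNorm G 2 (FunctionSpaces.homSobolevMeasure (EuclideanSpace ℝ (Fin 3)) (1 / 2 : ℝ)) := by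
  set μ := FunctionSpaces.homSobolevMeasure (EuclideanSpace ℝ (Fin 3)) (1 / 2 : ℝ) with hμ
  have hμ' : μ = volume.withDensity fun ξ => ‖ξ‖ₑ := HomSobolevSymmetry.homSobolevMeasure_half_eq
  have hwd : ∀ h : EuclideanSpace ℝ (Fin 3) → ℝ≥0∞, ∫⁻ ξ, h ξ ∂μ = ∫⁻ ξ, ‖ξ‖ₑ * h ξ := fun h => by
    rw [hμ', lintegral_withDensity_eq_lintegral_mul_non_measurable₀ _ (by fun_prop)
      (Eventually.of_forall fun ξ => enorm_lt_top)]
    rfl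
  have h0 : ∀ᵐ ξ ∂(volume : Measure (EuclideanSpace ℝ (Fin 3))), ξ ≠ 0 := by
    rw [ae_iff]; simp [measure_singleton]
  set a : EuclideanSpace ℝ (Fin 3) → ℝ≥0∞ := fun ξ => ‖ξ‖ₑ⁻¹ * ‖φ ξ‖ₑ with ha_def
  set b : EuclideanSpace ℝ (Fin 3) → ℝ≥0∞ := fun ξ => ‖G ξ‖ₑ with hb_def
  have ha : AEMeasurable a μ :=
    (measurable_enorm.inv.mul φ.continuous.measurable.enorm).aemeasurable
  have hb : AEMeasurable b μ := hG.enorm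
  have h1 : ∫⁻ ξ, ‖φ ξ • G ξ‖ₑ = ∫⁻ ξ, (a * b) ξ ∂μ := by
    rw [hwd]
    refine lintegral_congr_ae (h0.mono fun ξ hξ => ?_)
    have hx0 : (‖ξ‖ₑ : ℝ≥0∞) ≠ 0 := by simpa using hξ
    simp only [ha_def, hb_def, Pi.mul_apply]
    rw [enorm_smul, ← mul_assoc, ← mul_assoc, ENNReal.mul_inv_cancel hx0 enorm_ne_top, one_mul]
  have h2 := ENNReal.lintegral_mul_le_Lp_mul_Lq μ Real.HolderConjugate.two_two ha hb
  have h3 : (∫⁻ ξ, b ξ ^ (2 : ℝ) ∂μ) ^ (1 / (2 : ℝ)) = eLpNorm G 2 μ := by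
    rw [eLpNorm_eq_lintegral_rpow_enorm_toReal two_ne_zero ENNReal.ofNat_ne_top]
    simp [hb_def]
  have h4 : ∫⁻ ξ, a ξ ^ (2 : ℝ) ∂μ = ∫⁻ ξ, ‖φ ξ‖ₑ ^ 2 * ‖ξ‖ₑ⁻¹ := by
    rw [hwd]
    refine lintegral_congr_ae (h0.mono fun ξ hξ => ?_)
    have hx0 : (‖ξ‖ₑ : ℝ≥0∞) ≠ 0 := by simpa using hξ
    simp only [ha_def, ENNReal.rpow_ofNat]
    rw [mul_pow, ← mul_assoc, pow_two, ← mul_assoc, ENNReal.mul_inv_cancel hx0 enorm_ne_top,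
      one_mul, mul_comm]
  rw [h1]
  rw [h4, h3] at h2
  simpa using h2

/-- The pairing `ξ ↦ φ(ξ) • G(ξ)` of a Schwartz function with an element of `L²(‖ξ‖ dξ; F)` is
Lebesgue integrable on `ℝ³` (`lintegral_enorm_smul_le`,
`lintegral_enorm_sq_mul_inv_enorm_lt_top`; Bahouri–Chemin–Danchin 2011, Prop. 1.34/1.36:
`Ḣ^{1/2}(ℝ³) ⊂ 𝓢'`). [cite: BahouriCheminDanchin2011, Prop. 1.36] -/
theorem _root_.Literature.Analysis.FunctionSpaces.HomSobolev.integrable_smul_of_memLp_half (φ : 𝓢(EuclideanSpace ℝ (Fin 3), ℂ))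
    {G : EuclideanSpace ℝ (Fin 3) → F}
    (hG : MemLp G 2 (FunctionSpaces.homSobolevMeasure (EuclideanSpace ℝ (Fin 3)) (1 / 2 : ℝ))) :
    Integrable (fun ξ => φ ξ • G ξ) volume := by
  have hac : (volume : Measure (EuclideanSpace ℝ (Fin 3))) ≪
      FunctionSpaces.homSobolevMeasure (EuclideanSpace ℝ (Fin 3)) (1 / 2 : ℝ) :=
    HomSobolevSymmetry.volume_absolutelyContinuous_homSobolevMeasure_half
  refine ⟨φ.continuous.aestronglyMeasurable.smul (hG.1.mono_ac hac), ?_⟩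
  show ∫⁻ ξ, ‖φ ξ • G ξ‖ₑ < ∞
  refine lt_of_le_of_lt (lintegral_enorm_smul_le φ hG.1) ?_
  exact ENNReal.mul_lt_top (ENNReal.rpow_lt_top_of_nonneg (by norm_num)
    (lintegral_enorm_sq_mul_inv_enorm_lt_top φ).ne) hG.eLpNorm_lt_top

/-- `‖∫ φ • G‖ ≤ (∫ |φ|² ‖ξ‖⁻¹)^{1/2} ‖G‖_{L²(‖ξ‖dξ)}` (Bahouri–Chemin–Danchin 2011, Prop. 1.36).
[cite: BahouriCheminDanchin2011, Prop. 1.36] -/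
theorem _root_.Literature.Analysis.FunctionSpaces.HomSobolev.enorm_integral_smul_le (φ : 𝓢(EuclideanSpace ℝ (Fin 3), ℂ))
    {G : EuclideanSpace ℝ (Fin 3) → F}
    (hG : AEStronglyMeasurable G (FunctionSpaces.homSobolevMeasure (EuclideanSpace ℝ (Fin 3)) (1 / 2 : ℝ))) :
    ‖∫ ξ, φ ξ • G ξ‖ₑ ≤ (∫⁻ ξ, ‖φ ξ‖ₑ ^ 2 * ‖ξ‖ₑ⁻¹) ^ (1 / 2 : ℝ) *
      eLpNorm G 2 (FunctionSpaces.homSobolevMeasure (EuclideanSpace ℝ (Fin 3)) (1 / 2 : ℝ)) :=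
  (enorm_integral_le_lintegral_enorm _).trans (lintegral_enorm_smul_le φ hG)

/-! ## Weak convergence in `Ḣ^{1/2}(ℝ³)` and pairings with Schwartz functions -/

/-- **Weak `Ḣ^{1/2}` convergence implies convergence of pairings with Schwartz functions.** If
`gₙ ⇀ g` weakly in the Hilbert space `Ḣ^{1/2}(ℝ³; F)` (`⟪gₙ, w⟫ → ⟪g, w⟫` for all `w`), then
`⟪c, ∫ φ • gₙ⟫ → ⟪c, ∫ φ • g⟫` for every Schwartz `φ` and `c ∈ F`: the functional
`g ↦ ⟪c, ∫ φ • g⟫` is bounded (`enorm_integral_smul_le`), hence of the form `⟪w, ·⟫`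
(Fréchet–Riesz). Bahouri–Chemin–Danchin 2011, Prop. 1.36 (`Ḣ^{-s} = (Ḣ^s)'`); Rusin–Šverák 2011,
proof of Cor. 4.3 / Thm. 4.2 (weak limits of data are limits in `𝓢'`).
[cite: BahouriCheminDanchin2011, Prop. 1.36] -/
theorem _root_.Literature.Analysis.FunctionSpaces.HomSobolev.tendsto_inner_integral_smul_toLp [CompleteSpace F]
    {gseq : ℕ → HomSobolev (EuclideanSpace ℝ (Fin 3)) F (1 / 2 : ℝ)}
    {glim : HomSobolev (EuclideanSpace ℝ (Fin 3)) F (1 / 2 : ℝ)}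
    (hw : ∀ w : HomSobolev (EuclideanSpace ℝ (Fin 3)) F (1 / 2 : ℝ),
      Tendsto (fun n => ⟪gseq n, w⟫_ℂ) atTop (𝓝 ⟪glim, w⟫_ℂ))
    (φ : 𝓢(EuclideanSpace ℝ (Fin 3), ℂ)) (c : F) :
    Tendsto (fun n => ⟪c, ∫ ξ, φ ξ • ((toLp (1 / 2 : ℝ) (gseq n) :
        Lp F 2 (FunctionSpaces.homSobolevMeasure (EuclideanSpace ℝ (Fin 3)) (1 / 2 : ℝ))) :
          EuclideanSpace ℝ (Fin 3) → F) ξ⟫_ℂ) atTop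
      (𝓝 ⟪c, ∫ ξ, φ ξ • ((toLp (1 / 2 : ℝ) glim :
        Lp F 2 (FunctionSpaces.homSobolevMeasure (EuclideanSpace ℝ (Fin 3)) (1 / 2 : ℝ))) :
          EuclideanSpace ℝ (Fin 3) → F) ξ⟫_ℂ) := by
  set μ := FunctionSpaces.homSobolevMeasure (EuclideanSpace ℝ (Fin 3)) (1 / 2 : ℝ) with hμ
  have hac : (volume : Measure (EuclideanSpace ℝ (Fin 3))) ≪ μ :=
    HomSobolevSymmetry.volume_absolutelyContinuous_homSobolevMeasure_half
  set P : HomSobolev (EuclideanSpace ℝ (Fin 3)) F (1 / 2 : ℝ) → F := fun g =>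
    ∫ ξ, φ ξ • ((toLp (1 / 2 : ℝ) g : Lp F 2 μ) : EuclideanSpace ℝ (Fin 3) → F) ξ with hP
  have hint : ∀ g : HomSobolev (EuclideanSpace ℝ (Fin 3)) F (1 / 2 : ℝ),
      Integrable (fun ξ => φ ξ • ((toLp (1 / 2 : ℝ) g : Lp F 2 μ) : EuclideanSpace ℝ (Fin 3) → F) ξ)
        volume := fun g => integrable_smul_of_memLp_half φ (Lp.memLp _)
  have hadd : ∀ g g', P (g + g') = P g + P g' := fun g g' => by
    simp only [hP]
    rw [← integral_add (hint g) (hint g')]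
    refine integral_congr_ae ?_
    have h1 : ((toLp (1 / 2 : ℝ) (g + g') : Lp F 2 μ) : EuclideanSpace ℝ (Fin 3) → F) =ᵐ[μ]
        ((toLp (1 / 2 : ℝ) g : Lp F 2 μ) : EuclideanSpace ℝ (Fin 3) → F) +
          ((toLp (1 / 2 : ℝ) g' : Lp F 2 μ) : EuclideanSpace ℝ (Fin 3) → F) := by
      rw [map_add]
      exact Lp.coeFn_add _ _
    filter_upwards [hac.ae_eq h1] with ξ hξ
    rw [hξ, Pi.add_apply, smul_add]
  have hsmul : ∀ (a : ℂ) g, P (a • g) = a • P g := fun a g => by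
    simp only [hP]
    rw [← integral_smul]
    refine integral_congr_ae ?_
    have h1 : ((toLp (1 / 2 : ℝ) (a • g) : Lp F 2 μ) : EuclideanSpace ℝ (Fin 3) → F) =ᵐ[μ]
        a • ((toLp (1 / 2 : ℝ) g : Lp F 2 μ) : EuclideanSpace ℝ (Fin 3) → F) := by
      rw [map_smul]
      exact Lp.coeFn_smul _ _
    filter_upwards [hac.ae_eq h1] with ξ hξ
    rw [hξ, Pi.smul_apply, smul_comm]
  set K : ℝ := ((∫⁻ ξ, ‖φ ξ‖ₑ ^ 2 * ‖ξ‖ₑ⁻¹) ^ (1 / 2 : ℝ)).toReal with hK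
  have hKtop : (∫⁻ ξ, ‖φ ξ‖ₑ ^ 2 * ‖ξ‖ₑ⁻¹) ^ (1 / 2 : ℝ) ≠ ∞ :=
    ENNReal.rpow_ne_top_of_nonneg (by norm_num) (lintegral_enorm_sq_mul_inv_enorm_lt_top φ).ne
  have hbound : ∀ g, ‖P g‖ ≤ K * ‖g‖ := fun g => by
    have h := enorm_integral_smul_le φ (Lp.memLp (toLp (1 / 2 : ℝ) g : Lp F 2 μ)).1
    rw [← Lp.enorm_def] at h
    have h' := ENNReal.toReal_mono (ENNReal.mul_ne_top hKtop enorm_ne_top) h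
    rw [ENNReal.toReal_mul, toReal_enorm, toReal_enorm] at h'
    exact h'
  let L : HomSobolev (EuclideanSpace ℝ (Fin 3)) F (1 / 2 : ℝ) →ₗ[ℂ] ℂ :=
    { toFun := fun g => ⟪c, P g⟫_ℂ
      map_add' := fun g g' => by simp only [hadd, inner_add_right]
      map_smul' := fun a g => by simp only [hsmul, inner_smul_right, RingHom.id_apply, smul_eq_mul] }
  have hL : ∀ g, ‖L g‖ ≤ ‖c‖ * K * ‖g‖ := fun g => by
    calc ‖L g‖ = ‖⟪c, P g⟫_ℂ‖ := rfl
      _ ≤ ‖c‖ * ‖P g‖ := norm_inner_le_norm _ _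
      _ ≤ ‖c‖ * (K * ‖g‖) := by
          gcongr
          exact hbound g
      _ = ‖c‖ * K * ‖g‖ := by ring
  set ℓ : HomSobolev (EuclideanSpace ℝ (Fin 3)) F (1 / 2 : ℝ) →L[ℂ] ℂ := L.mkContinuous _ hL with hℓ_def
  set w := (InnerProductSpace.toDual ℂ (HomSobolev (EuclideanSpace ℝ (Fin 3)) F (1 / 2 : ℝ))).symm ℓ
    with hw_def
  have hℓ : ∀ g, ⟪w, g⟫_ℂ = ⟪c, P g⟫_ℂ := fun g => by
    rw [hw_def, InnerProductSpace.toDual_symm_apply]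
    rfl
  have hconv : Tendsto (fun n => ⟪w, gseq n⟫_ℂ) atTop (𝓝 ⟪w, glim⟫_ℂ) := by
    have := (Complex.continuous_conj.tendsto _).comp (hw w)
    simpa only [Function.comp_def, inner_conj_symm] using this
  simpa only [hℓ] using hconv

/-- **Represented fields converge in `𝓢'` along weakly convergent representing classes.** If
`gₙ` represents `fₙ`, `g` represents `f` (`HomSobolev.Represents`), and `gₙ ⇀ g` weakly in
`Ḣ^{1/2}(ℝ³; F)`, then `⟪c, ∫ ψ • fₙ⟫ → ⟪c, ∫ ψ • f⟫` for every Schwartz `ψ` and `c ∈ F`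
(write `ψ = 𝓕φ`, `φ = 𝓕⁻¹ψ ∈ 𝓢`, and use the defining identity `∫ 𝓕φ • f = ∫ φ • g` together
with `tendsto_inner_integral_smul_toLp`). Rusin–Šverák 2011, Thm. 4.2 / Cor. 4.3: weak
`Ḣ^{1/2}` limits of the data are their distributional limits.
[cite: RusinSverak2011, Thm. 4.2 and proof of Cor. 4.3 (arXiv:0911.0500 pp. 7–8)] -/
theorem _root_.Literature.Analysis.FunctionSpaces.HomSobolev.Represents.tendsto_inner_integral_smul [CompleteSpace F]
    {gseq : ℕ → HomSobolev (EuclideanSpace ℝ (Fin 3)) F (1 / 2 : ℝ)}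
    {glim : HomSobolev (EuclideanSpace ℝ (Fin 3)) F (1 / 2 : ℝ)}
    (hw : ∀ w : HomSobolev (EuclideanSpace ℝ (Fin 3)) F (1 / 2 : ℝ),
      Tendsto (fun n => ⟪gseq n, w⟫_ℂ) atTop (𝓝 ⟪glim, w⟫_ℂ))
    {fseq : ℕ → EuclideanSpace ℝ (Fin 3) → F} {flim : EuclideanSpace ℝ (Fin 3) → F}
    (hseq : ∀ n, (gseq n).Represents (fseq n)) (hlim : glim.Represents flim)
    (ψ : 𝓢(EuclideanSpace ℝ (Fin 3), ℂ)) (c : F) :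
    Tendsto (fun n => ⟪c, ∫ x, ψ x • fseq n x⟫_ℂ) atTop (𝓝 ⟪c, ∫ x, ψ x • flim x⟫_ℂ) := by
  set φ : 𝓢(EuclideanSpace ℝ (Fin 3), ℂ) := 𝓕⁻ ψ with hφ_def
  have hφ : 𝓕 φ = ψ := fourier_fourierInv_eq ψ
  have h1 : ∀ n, ∫ x, ψ x • fseq n x = ∫ ξ, φ ξ • ((toLp (1 / 2 : ℝ) (gseq n) :
      Lp F 2 (FunctionSpaces.homSobolevMeasure (EuclideanSpace ℝ (Fin 3)) (1 / 2 : ℝ))) :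
        EuclideanSpace ℝ (Fin 3) → F) ξ := fun n => by
    rw [← (hseq n).2.2 φ, hφ]
  have h2 : ∫ x, ψ x • flim x = ∫ ξ, φ ξ • ((toLp (1 / 2 : ℝ) glim :
      Lp F 2 (FunctionSpaces.homSobolevMeasure (EuclideanSpace ℝ (Fin 3)) (1 / 2 : ℝ))) :
        EuclideanSpace ℝ (Fin 3) → F) ξ := by
    rw [← hlim.2.2 φ, hφ]
  simp only [h1, h2]
  exact tendsto_inner_integral_smul_toLp hw φ c

end Half

/-! ## Every class in `Ḣ^{1/2}(ℝ³)` is represented by an `L³` function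

From the tree's named fact `eLpNorm_three_le_eHomSobolevSeminorm_half` (the Sobolev inequality
`‖f‖_{L³} ≤ C ‖f‖_{Ḣ^{1/2}}` for `f ∈ L²`, Bahouri–Chemin–Danchin 2011, Thm. 1.38) by density:
truncate `g ∈ L²(‖ξ‖ dξ)` away from the origin (`gₙ = 1_{‖ξ‖ ≥ 1/(n+1)} g ∈ L² ∩ L²(‖ξ‖ dξ)`), take
`fₙ = 𝓕⁻¹ gₙ ∈ L²` (Plancherel), observe `‖fₙ - fₘ‖_{L³} ≤ C ‖gₙ - gₘ‖_{L²(‖ξ‖dξ)} → 0`, and pass to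
the limit in `L³` and in the pairings. -/

section SobolevRepr

universe u

variable {F : Type u} [NormedAddCommGroup F] [InnerProductSpace ℂ F] [CompleteSpace F]

/-- The function-level `Ḣ^s` seminorm only depends on the a.e. class of the function.
[folklore] -/
theorem _root_.Function.eHomSobolevSeminorm_congr_ae {s : ℝ} {f f' : EuclideanSpace ℝ (Fin 3) → F}
    (h : f =ᵐ[volume] f') :
    Function.eHomSobolevSeminorm s f = Function.eHomSobolevSeminorm s f' := by
  by_cases hf : MemLp f 2 (volume : Measure (EuclideanSpace ℝ (Fin 3)))
  · have hf' : MemLp f' 2 (volume : Measure (EuclideanSpace ℝ (Fin 3))) := hf.ae_eq h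
    rw [Function.eHomSobolevSeminorm, Function.eHomSobolevSeminorm, dif_pos hf, dif_pos hf',
      MemLp.toLp_congr hf hf' h]
  · have hf' : ¬ MemLp f' 2 (volume : Measure (EuclideanSpace ℝ (Fin 3))) :=
      fun h' => hf (h'.ae_eq h.symm)
    rw [Function.eHomSobolevSeminorm, Function.eHomSobolevSeminorm, dif_neg hf, dif_neg hf']

/-- The `Ḣ^{1/2}(ℝ³)` seminorm of an `L²` function on the Fourier side: if `𝓕Ψ = K` a.e., then
`‖Ψ‖_{Ḣ^{1/2}} = ‖K‖_{L²(‖ξ‖ dξ)}` (Bahouri–Chemin–Danchin 2011, Def. 1.31).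
[cite: BahouriCheminDanchin2011, Def. 1.31] -/
theorem _root_.Literature.Analysis.FunctionSpaces.HomSobolev.eHomSobolevSeminorm_half_eq_eLpNorm (Ψ : Lp F 2 (volume : Measure (EuclideanSpace ℝ (Fin 3))))
    {K : EuclideanSpace ℝ (Fin 3) → F}
    (hK : ((𝓕 Ψ : Lp F 2 (volume : Measure (EuclideanSpace ℝ (Fin 3)))) : EuclideanSpace ℝ (Fin 3) → F)
      =ᵐ[volume] K) :
    Function.eHomSobolevSeminorm (1 / 2 : ℝ) (Ψ : EuclideanSpace ℝ (Fin 3) → F) =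
      eLpNorm K 2 (FunctionSpaces.homSobolevMeasure (EuclideanSpace ℝ (Fin 3)) (1 / 2 : ℝ)) := by
  have hmem : MemLp (Ψ : EuclideanSpace ℝ (Fin 3) → F) 2 (volume : Measure (EuclideanSpace ℝ (Fin 3))) :=
    Lp.memLp Ψ
  rw [Function.eHomSobolevSeminorm, dif_pos hmem, Literature.Analysis.FunctionSpaces.eHomSobolevSeminorm, Lp.toLp_coeFn Ψ hmem,
    HomSobolevSymmetry.homSobolevMeasure_half_eq,
    eLpNorm_eq_lintegral_rpow_enorm_toReal two_ne_zero ENNReal.ofNat_ne_top,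
    lintegral_withDensity_eq_lintegral_mul_non_measurable₀ _ (by fun_prop)
      (Eventually.of_forall fun ξ => enorm_lt_top)]
  simp only [ENNReal.toReal_ofNat, Pi.mul_apply, ENNReal.rpow_ofNat]
  congr 1
  refine lintegral_congr_ae (hK.mono fun ξ hξ => ?_)
  simp only [hξ]
  norm_num

/-- **Every class `g ∈ Ḣ^{1/2}(ℝ³)` is represented by an `L³` function**, granted the Sobolev
inequality `eLpNorm_three_le_eHomSobolevSeminorm_half` (Bahouri–Chemin–Danchin 2011, Thm. 1.38:
`Ḣ^{1/2}(ℝ³) ↪ L³(ℝ³)`): the truncations `gₙ = 1_{‖ξ‖ ≥ 1/(n+1)} g` lie in `L² ∩ L²(‖ξ‖ dξ)` and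
converge to `g` in `L²(‖ξ‖ dξ)`; `fₙ = 𝓕⁻¹ gₙ ∈ L²` satisfy `‖fₙ - fₘ‖_{L³} ≤ C ‖gₙ - gₘ‖`, hence
converge in `L³` to some `f`, and `∫ 𝓕φ • f = lim ∫ 𝓕φ • fₙ = lim ∫ φ • gₙ = ∫ φ • g` (Parseval
for `fₙ ∈ L²`, `integral_fourier_smul_eq_integral_smul_fourier_Lp`; continuity of the pairings in
`L³` and in `L²(‖ξ‖ dξ)`, `enorm_integral_smul_le`).
[cite: BahouriCheminDanchin2011, Thm. 1.38 (d = 3, s = 1/2) with Prop. 1.34] -/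
theorem _root_.Literature.Analysis.FunctionSpaces.HomSobolev.exists_represents_memLp_three (hS : FunctionSpaces.eLpNorm_three_le_eHomSobolevSeminorm_half.{u})
    (g : HomSobolev (EuclideanSpace ℝ (Fin 3)) F (1 / 2 : ℝ)) :
    ∃ f : EuclideanSpace ℝ (Fin 3) → F, MemLp f 3 volume ∧ g.Represents f := by
  obtain ⟨C, hC⟩ := @hS F _ _ _
  haveI : Fact ((1 : ℝ≥0∞) ≤ 3) := ⟨by norm_num⟩
  -- the Hölder pair `(3/2, 3)`
  have hHT : ENNReal.HolderTriple (3 / 2) 3 1 := by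
    refine ⟨?_⟩
    have h1 : (3 / 2 : ℝ≥0∞)⁻¹ = 2 * 3⁻¹ := by
      rw [div_eq_mul_inv, ENNReal.mul_inv (Or.inl (by norm_num)) (Or.inl (by norm_num)), inv_inv,
        mul_comm]
    rw [h1, inv_one]
    calc (2 : ℝ≥0∞) * 3⁻¹ + 3⁻¹ = (2 + 1) * 3⁻¹ := by rw [add_mul, one_mul]
      _ = 3 * 3⁻¹ := by norm_num
      _ = 1 := ENNReal.mul_inv_cancel (by norm_num) (by norm_num)
  set μ := FunctionSpaces.homSobolevMeasure (EuclideanSpace ℝ (Fin 3)) (1 / 2 : ℝ) with hμ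
  have hμ' : μ = volume.withDensity fun ξ => ‖ξ‖ₑ := HomSobolevSymmetry.homSobolevMeasure_half_eq
  have hac : (volume : Measure (EuclideanSpace ℝ (Fin 3))) ≪ μ :=
    HomSobolevSymmetry.volume_absolutelyContinuous_homSobolevMeasure_half
  have hac' : μ ≪ (volume : Measure (EuclideanSpace ℝ (Fin 3))) :=
    HomSobolevSymmetry.homSobolevMeasure_half_absolutelyContinuous_volume
  have hwd : ∀ h : EuclideanSpace ℝ (Fin 3) → ℝ≥0∞, ∫⁻ ξ, h ξ ∂μ = ∫⁻ ξ, ‖ξ‖ₑ * h ξ := fun h => by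
    rw [hμ', lintegral_withDensity_eq_lintegral_mul_non_measurable₀ _ (by fun_prop)
      (Eventually.of_forall fun ξ => enorm_lt_top)]
    rfl
  have h0 : ∀ᵐ ξ ∂(volume : Measure (EuclideanSpace ℝ (Fin 3))), ξ ≠ 0 := by
    rw [ae_iff]; simp [measure_singleton]
  -- the Fourier-side representative and its truncations away from the origin
  set G : EuclideanSpace ℝ (Fin 3) → F :=
    ((toLp (1 / 2 : ℝ) g : Lp F 2 μ) : EuclideanSpace ℝ (Fin 3) → F) with hG_def
  have hG : MemLp G 2 μ := Lp.memLp _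
  set A : ℕ → Set (EuclideanSpace ℝ (Fin 3)) :=
    fun n => (Metric.ball (0 : EuclideanSpace ℝ (Fin 3)) (((n : ℝ) + 1)⁻¹))ᶜ with hA_def
  have hAm : ∀ n, MeasurableSet (A n) := fun n => measurableSet_ball.compl
  set Gn : ℕ → EuclideanSpace ℝ (Fin 3) → F := fun n => (A n).indicator G with hGn_def
  have ha : ∀ n, MemLp (Gn n) 2 μ := fun n => hG.indicator (hAm n)
  -- the truncations are in `L²(volume)`
  have hb : ∀ n, MemLp (Gn n) 2 (volume : Measure (EuclideanSpace ℝ (Fin 3))) := fun n => by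
    refine ⟨(hG.1.mono_ac hac).indicator (hAm n), ?_⟩
    rw [eLpNorm_lt_top_iff_lintegral_rpow_enorm_lt_top two_ne_zero ENNReal.ofNat_ne_top]
    simp only [ENNReal.toReal_ofNat, ENNReal.rpow_ofNat]
    have hfin : ∫⁻ ξ, ‖Gn n ξ‖ₑ ^ 2 ∂μ < ∞ := by
      have := lintegral_rpow_enorm_lt_top_of_eLpNorm_lt_top two_ne_zero ENNReal.ofNat_ne_top
        (ha n).eLpNorm_lt_top
      simpa only [ENNReal.toReal_ofNat, ENNReal.rpow_ofNat] using this
    have hle : ∀ ξ, ‖Gn n ξ‖ₑ ^ 2 ≤ ENNReal.ofReal ((n : ℝ) + 1) * (‖ξ‖ₑ * ‖Gn n ξ‖ₑ ^ 2) :=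
      fun ξ => by
      by_cases hξ : ξ ∈ A n
      · have h1 : (1 : ℝ≥0∞) ≤ ENNReal.ofReal ((n : ℝ) + 1) * ‖ξ‖ₑ := by
          rw [← ofReal_norm, ← ENNReal.ofReal_mul (by positivity), ← ENNReal.ofReal_one]
          refine ENNReal.ofReal_le_ofReal ?_
          have hξ' : ((n : ℝ) + 1)⁻¹ ≤ ‖ξ‖ := by simpa [hA_def] using hξ
          calc (1 : ℝ) = ((n : ℝ) + 1) * ((n : ℝ) + 1)⁻¹ := by field_simp
            _ ≤ ((n : ℝ) + 1) * ‖ξ‖ := by gcongr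
        calc ‖Gn n ξ‖ₑ ^ 2 = 1 * ‖Gn n ξ‖ₑ ^ 2 := (one_mul _).symm
          _ ≤ (ENNReal.ofReal ((n : ℝ) + 1) * ‖ξ‖ₑ) * ‖Gn n ξ‖ₑ ^ 2 := by gcongr
          _ = _ := by ring
      · simp [hGn_def, Set.indicator_of_notMem hξ]
    calc ∫⁻ ξ, ‖Gn n ξ‖ₑ ^ 2 ≤ ∫⁻ ξ, ENNReal.ofReal ((n : ℝ) + 1) * (‖ξ‖ₑ * ‖Gn n ξ‖ₑ ^ 2) :=
          lintegral_mono hle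
      _ = ENNReal.ofReal ((n : ℝ) + 1) * ∫⁻ ξ, ‖Gn n ξ‖ₑ ^ 2 ∂μ := by
          rw [lintegral_const_mul' _ _ ENNReal.ofReal_ne_top, hwd]
      _ < ∞ := ENNReal.mul_lt_top ENNReal.ofReal_lt_top hfin
  -- the physical-side approximants `fₙ = 𝓕⁻¹ gₙ ∈ L²`
  set H : ℕ → Lp F 2 (volume : Measure (EuclideanSpace ℝ (Fin 3))) := fun n => (hb n).toLp (Gn n)
    with hH_def
  have hHae : ∀ n, (H n : EuclideanSpace ℝ (Fin 3) → F) =ᵐ[volume] Gn n := fun n => (hb n).coeFn_toLp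
  set Φ : ℕ → Lp F 2 (volume : Measure (EuclideanSpace ℝ (Fin 3))) := fun n => 𝓕⁻ (H n) with hΦ_def
  have hΦ : ∀ n, (𝓕 (Φ n) : Lp F 2 (volume : Measure (EuclideanSpace ℝ (Fin 3)))) = H n := fun n =>
    fourier_fourierInv_eq (H n)
  have hΦsub : ∀ n m, (𝓕 (Φ n - Φ m) : Lp F 2 (volume : Measure (EuclideanSpace ℝ (Fin 3)))) =
      H n - H m := fun n m => by
    rw [← hΦ n, ← hΦ m]
    exact (Lp.fourierTransformₗᵢ (EuclideanSpace ℝ (Fin 3)) F).map_sub (Φ n) (Φ m)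
  -- `Ḣ^{1/2}` seminorms of the approximants and of their differences
  have hsemi : ∀ n m, Function.eHomSobolevSeminorm (1 / 2 : ℝ)
      ((Φ n : EuclideanSpace ℝ (Fin 3) → F) - (Φ m : EuclideanSpace ℝ (Fin 3) → F)) =
        eLpNorm (Gn n - Gn m) 2 μ := fun n m => by
    rw [Function.eHomSobolevSeminorm_congr_ae (Lp.coeFn_sub (Φ n) (Φ m)).symm]
    refine eHomSobolevSeminorm_half_eq_eLpNorm (Φ n - Φ m) ?_
    rw [hΦsub]
    filter_upwards [Lp.coeFn_sub (H n) (H m), hHae n, hHae m] with x h1 h2 h3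
    rw [h1, Pi.sub_apply, h2, h3, Pi.sub_apply]
  have hsemi1 : ∀ n, Function.eHomSobolevSeminorm (1 / 2 : ℝ) (Φ n : EuclideanSpace ℝ (Fin 3) → F) =
      eLpNorm (Gn n) 2 μ := fun n => by
    refine eHomSobolevSeminorm_half_eq_eLpNorm (Φ n) ?_
    rw [hΦ]
    exact hHae n
  -- `L³` control from the Sobolev inequality
  have h3n : ∀ n, MemLp (Φ n : EuclideanSpace ℝ (Fin 3) → F) 3 volume := fun n => by
    refine ⟨(Lp.memLp (Φ n)).1, lt_of_le_of_lt (hC _ (Lp.memLp (Φ n))) ?_⟩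
    rw [hsemi1]
    exact ENNReal.mul_lt_top ENNReal.coe_lt_top (ha n).eLpNorm_lt_top
  -- `gₙ → g` in `L²(‖ξ‖ dξ)`
  have hconvG : Tendsto (fun n => eLpNorm (Gn n - G) 2 μ) atTop (𝓝 0) := by
    have hlin : Tendsto (fun n => ∫⁻ ξ, ‖(Gn n - G) ξ‖ₑ ^ 2 ∂μ) atTop (𝓝 (∫⁻ _ξ, (0 : ℝ≥0∞) ∂μ)) := by
      refine tendsto_lintegral_of_dominated_convergence' (fun ξ => ‖G ξ‖ₑ ^ 2)
        (fun n => (((ha n).sub hG).1.enorm.pow_const _)) (fun n => Eventually.of_forall fun ξ => ?_)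
        ?_ ?_
      · simp only [Pi.sub_apply, hGn_def]
        have : (A n).indicator G ξ - G ξ = -((A n)ᶜ.indicator G ξ) := by
          rw [eq_neg_iff_add_eq_zero, sub_add_eq_add_sub, sub_eq_zero]
          exact congrFun (Set.indicator_self_add_compl (A n) G) ξ
        rw [this, enorm_neg]
        gcongr
        exact enorm_indicator_le_enorm_self _ _
      · have := lintegral_rpow_enorm_lt_top_of_eLpNorm_lt_top two_ne_zero ENNReal.ofNat_ne_top
          hG.eLpNorm_lt_top
        simp only [ENNReal.toReal_ofNat, ENNReal.rpow_ofNat] at this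
        exact this.ne
      · filter_upwards [hac'.ae_le h0] with ξ hξ
        have hξ' : (ξ : EuclideanSpace ℝ (Fin 3)) ≠ 0 := hξ
        -- eventually `ξ ∉ ball 0 (n+1)⁻¹`, so the truncation error vanishes at `ξ`
        have hev : ∀ᶠ n : ℕ in atTop, ‖(Gn n - G) ξ‖ₑ ^ 2 = 0 := by
          have hpos : 0 < ‖ξ‖ := norm_pos_iff.2 hξ'
          obtain ⟨N, hN⟩ := exists_nat_gt ‖ξ‖⁻¹
          refine eventually_atTop.2 ⟨N, fun n hn => ?_⟩
          have hmem : ξ ∈ A n := by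
            simp only [hA_def, Set.mem_compl_iff, Metric.mem_ball, dist_zero_right, not_lt]
            rw [inv_le_comm₀ (by positivity) hpos]
            have : (N : ℝ) ≤ n := by exact_mod_cast hn
            linarith
          simp [hGn_def, Set.indicator_of_mem hmem]
        exact tendsto_const_nhds.congr' (hev.mono fun n hn => hn.symm)
    rw [lintegral_zero] at hlin
    have h2 : ∀ n, eLpNorm (Gn n - G) 2 μ = (∫⁻ ξ, ‖(Gn n - G) ξ‖ₑ ^ 2 ∂μ) ^ (1 / 2 : ℝ) := fun n => by
      rw [eLpNorm_eq_lintegral_rpow_enorm_toReal two_ne_zero ENNReal.ofNat_ne_top]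
      simp [ENNReal.rpow_ofNat]
    simp only [h2]
    have := ((ENNReal.continuous_rpow_const (y := (1 / 2 : ℝ))).tendsto (0 : ℝ≥0∞)).comp hlin
    rw [ENNReal.zero_rpow_of_pos (show (0 : ℝ) < 1 / 2 by norm_num)] at this
    exact this
  -- the approximants are Cauchy in `L³`
  set T : ℕ → Lp F 3 (volume : Measure (EuclideanSpace ℝ (Fin 3))) := fun n => (h3n n).toLp _
    with hT_def
  have hTae : ∀ n, (T n : EuclideanSpace ℝ (Fin 3) → F) =ᵐ[volume] (Φ n : EuclideanSpace ℝ (Fin 3) → F) :=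
    fun n => (h3n n).coeFn_toLp
  have hdistT : ∀ n m, edist (T n) (T m) ≤ C * eLpNorm (Gn n - Gn m) 2 μ := fun n m => by
    rw [Lp.edist_def, eLpNorm_congr_ae ((hTae n).sub (hTae m)), ← hsemi n m]
    exact hC _ ((Lp.memLp _).sub (Lp.memLp _))
  set gL : ℕ → Lp F 2 μ := fun n => (ha n).toLp (Gn n) with hgL_def
  have hdistg : ∀ n m, edist (gL n) (gL m) = eLpNorm (Gn n - Gn m) 2 μ := fun n m => by
    rw [Lp.edist_def]
    exact eLpNorm_congr_ae (((ha n).coeFn_toLp).sub ((ha m).coeFn_toLp))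
  have hcauchyG : CauchySeq gL := by
    refine Filter.Tendsto.cauchySeq (x := (toLp (1 / 2 : ℝ) g : Lp F 2 μ)) ?_
    rw [tendsto_iff_edist_tendsto_0]
    refine (tendsto_congr fun n => ?_).2 hconvG
    rw [Lp.edist_def]
    exact eLpNorm_congr_ae (((ha n).coeFn_toLp).sub EventuallyEq.rfl)
  have hcauchyT : CauchySeq T := by
    rw [Metric.cauchySeq_iff] at hcauchyG ⊢
    intro ε hε
    obtain ⟨N, hN⟩ := hcauchyG (ε / ((C : ℝ) + 1)) (by positivity)
    refine ⟨N, fun m hm n hn => ?_⟩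
    have h1 : dist (T m) (T n) ≤ (C : ℝ) * dist (gL m) (gL n) := by
      rw [dist_edist, dist_edist, ← ENNReal.coe_toReal, ← ENNReal.toReal_mul]
      refine ENNReal.toReal_mono (ENNReal.mul_ne_top ENNReal.coe_ne_top (edist_ne_top _ _)) ?_
      rw [hdistg]
      exact hdistT m n
    have h2 : (C : ℝ) * (ε / ((C : ℝ) + 1)) < ε := by
      rw [mul_div_assoc', div_lt_iff₀ (by positivity)]
      nlinarith [C.coe_nonneg]
    calc dist (T m) (T n) ≤ (C : ℝ) * dist (gL m) (gL n) := h1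
      _ ≤ (C : ℝ) * (ε / ((C : ℝ) + 1)) := by
          gcongr
          exact (hN m hm n hn).le
      _ < ε := h2
  obtain ⟨Tlim, hTlim⟩ := cauchySeq_tendsto_of_complete hcauchyT
  -- the limit `f ∈ L³` represents `g`
  refine ⟨(Tlim : EuclideanSpace ℝ (Fin 3) → F), Lp.memLp Tlim, fun φ => ?_, fun φ => ?_, fun φ => ?_⟩
  · haveI := hHT
    have hm : MemLp ((⇑(𝓕 φ : 𝓢(EuclideanSpace ℝ (Fin 3), ℂ))) • (Tlim : EuclideanSpace ℝ (Fin 3) → F))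
        1 (volume : Measure (EuclideanSpace ℝ (Fin 3))) :=
      (Lp.memLp Tlim).smul ((𝓕 φ : 𝓢(EuclideanSpace ℝ (Fin 3), ℂ)).memLp (3 / 2) _)
    exact memLp_one_iff_integrable.1 hm
  · exact integrable_smul_of_memLp_half φ hG
  · haveI := hHT
    set ψ : 𝓢(EuclideanSpace ℝ (Fin 3), ℂ) := 𝓕 φ with hψ_def
    -- the pairings of the approximants: `∫ 𝓕φ • fₙ = ∫ φ • gₙ`
    have hpair : ∀ n, ∫ x, ψ x • (Φ n : EuclideanSpace ℝ (Fin 3) → F) x = ∫ ξ, φ ξ • Gn n ξ :=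
      fun n => by
      rw [hψ_def, integral_fourier_smul_eq_integral_smul_fourier_Lp φ (Φ n), hΦ n]
      exact integral_congr_ae ((hHae n).mono fun ξ hξ => by simp only [hξ])
    -- left-hand sides converge to `∫ 𝓕φ • f` (`fₙ → f` in `L³`, `𝓕φ ∈ L^{3/2}`)
    have hintn : ∀ n, Integrable (fun x => ψ x • (Φ n : EuclideanSpace ℝ (Fin 3) → F) x) volume :=
      fun n => memLp_one_iff_integrable.1 ((h3n n).smul (ψ.memLp (3 / 2) _))
    have hintlim : Integrable (fun x => ψ x • (Tlim : EuclideanSpace ℝ (Fin 3) → F) x) volume :=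
      memLp_one_iff_integrable.1 ((Lp.memLp Tlim).smul (ψ.memLp (3 / 2) _))
    have hL : Tendsto (fun n => ∫ x, ψ x • (Φ n : EuclideanSpace ℝ (Fin 3) → F) x) atTop
        (𝓝 (∫ x, ψ x • (Tlim : EuclideanSpace ℝ (Fin 3) → F) x)) := by
      rw [tendsto_iff_edist_tendsto_0]
      have hT0 : Tendsto (fun n => edist (T n) Tlim) atTop (𝓝 0) :=
        tendsto_iff_edist_tendsto_0.1 hTlim
      have hup : Tendsto (fun n => eLpNorm ψ (3 / 2) volume * edist (T n) Tlim) atTop (𝓝 0) := by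
        have := ENNReal.Tendsto.const_mul hT0 (Or.inr (ψ.memLp (3 / 2)
          (volume : Measure (EuclideanSpace ℝ (Fin 3)))).eLpNorm_ne_top)
        rwa [mul_zero] at this
      refine tendsto_of_tendsto_of_tendsto_of_le_of_le tendsto_const_nhds hup
        (fun n => zero_le) fun n => ?_
      rw [edist_eq_enorm_sub, ← integral_sub (hintn n) hintlim]
      refine (enorm_integral_le_lintegral_enorm _).trans ?_
      rw [← eLpNorm_one_eq_lintegral_enorm]
      have hsm : (fun x => ψ x • (Φ n : EuclideanSpace ℝ (Fin 3) → F) x -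
          ψ x • (Tlim : EuclideanSpace ℝ (Fin 3) → F) x) =
          (⇑ψ) • ((Φ n : EuclideanSpace ℝ (Fin 3) → F) - (Tlim : EuclideanSpace ℝ (Fin 3) → F)) := by
        funext x
        simp [smul_sub]
      rw [hsm]
      refine (eLpNorm_smul_le_mul_eLpNorm (p := 3 / 2) (q := 3) (r := 1)
        ((Lp.memLp (Φ n)).1.sub (Lp.memLp Tlim).1)
        ψ.continuous.aestronglyMeasurable).trans (le_of_eq ?_)
      rw [Lp.edist_def, eLpNorm_congr_ae ((hTae n).sub EventuallyEq.rfl)]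
    -- right-hand sides converge to `∫ φ • g` (`gₙ → g` in `L²(‖ξ‖ dξ)`)
    have hR : Tendsto (fun n => ∫ ξ, φ ξ • Gn n ξ) atTop (𝓝 (∫ ξ, φ ξ • G ξ)) := by
      rw [tendsto_iff_edist_tendsto_0]
      have hKtop : (∫⁻ ξ, ‖φ ξ‖ₑ ^ 2 * ‖ξ‖ₑ⁻¹) ^ (1 / 2 : ℝ) ≠ ∞ :=
        ENNReal.rpow_ne_top_of_nonneg (by norm_num) (lintegral_enorm_sq_mul_inv_enorm_lt_top φ).ne
      have hup : Tendsto (fun n => (∫⁻ ξ, ‖φ ξ‖ₑ ^ 2 * ‖ξ‖ₑ⁻¹) ^ (1 / 2 : ℝ) *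
          eLpNorm (Gn n - G) 2 μ) atTop (𝓝 0) := by
        have := ENNReal.Tendsto.const_mul hconvG (Or.inr hKtop)
        rwa [mul_zero] at this
      refine tendsto_of_tendsto_of_tendsto_of_le_of_le tendsto_const_nhds hup
        (fun n => zero_le) fun n => ?_
      rw [edist_eq_enorm_sub, ← integral_sub (integrable_smul_of_memLp_half φ (ha n))
        (integrable_smul_of_memLp_half φ hG)]
      simp only [← smul_sub]
      exact enorm_integral_smul_le φ ((ha n).sub hG).1
    simp only [hpair] at hL
    exact tendsto_nhds_unique hL hR

end SobolevRepr

/-! ## Real vector fields: components, reality and divergence-freeness of weak limits -/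

section Real

/-- The Schwartz function attached to a real test function `θ ∈ C_c^∞(ℝ³)` (as `ℂ`-valued
function; Mathlib `HasCompactSupport.toSchwartzMap`). [folklore] -/
theorem _root_.Literature.Analysis.FunctionSpaces.HomSobolev.hasCompactSupport_ofReal_comp {θ : EuclideanSpace ℝ (Fin 3) → ℝ} (hθc : HasCompactSupport θ) :
    HasCompactSupport (Complex.ofReal ∘ θ) :=
  hθc.comp_left Complex.ofReal_zero

/-- Smoothness of `(θ : ℂ)` for smooth real `θ`. [folklore] -/
theorem _root_.Literature.Analysis.FunctionSpaces.HomSobolev.contDiff_ofReal_comp {θ : EuclideanSpace ℝ (Fin 3) → ℝ}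
    (hθ : ContDiff ℝ ((⊤ : ℕ∞) : WithTop ℕ∞) θ) :
    ContDiff ℝ ((⊤ : ℕ∞) : WithTop ℕ∞) (Complex.ofReal ∘ θ) :=
  Complex.ofRealCLM.contDiff.comp hθ

/-- **Components of the pairing of a real field with a real test function**: for
`θ ∈ C_c^∞(ℝ³; ℝ)` and a field `w : ℝ³ → ℝ³` with `θ • (complexify ∘ w)` integrable,
`⟪eᵢ, ∫ θ • complexify ∘ w⟫_ℂ = ∫ θ wᵢ` (a real number). [folklore] -/
theorem _root_.Literature.Analysis.FunctionSpaces.HomSobolev.inner_single_integral_smul_complexify {θ : EuclideanSpace ℝ (Fin 3) → ℝ}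
    (hθ : ContDiff ℝ ((⊤ : ℕ∞) : WithTop ℕ∞) θ) (hθc : HasCompactSupport θ)
    (w : EuclideanSpace ℝ (Fin 3) → EuclideanSpace ℝ (Fin 3))
    (hint : Integrable (fun x => ((hasCompactSupport_ofReal_comp hθc).toSchwartzMap
      (contDiff_ofReal_comp hθ)) x • FunctionSpaces.EuclideanSpace.complexify (w x)) volume)
    (i : Fin 3) :
    ⟪EuclideanSpace.single i (1 : ℂ), ∫ x, ((hasCompactSupport_ofReal_comp hθc).toSchwartzMap
      (contDiff_ofReal_comp hθ)) x • FunctionSpaces.EuclideanSpace.complexify (w x)⟫_ℂ =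
      ((∫ x, θ x * w x i : ℝ) : ℂ) := by
  have hci : ∀ v : EuclideanSpace ℂ (Fin 3), (EuclideanSpace.proj (𝕜 := ℂ) i) v = v i :=
    fun v => rfl
  rw [EuclideanSpace.inner_single_left, map_one, one_mul]
  change (EuclideanSpace.proj (𝕜 := ℂ) i) (∫ x, _ ) = _
  rw [← ContinuousLinearMap.integral_comp_comm _ hint, ← integral_complex_ofReal]
  refine integral_congr_ae (Eventually.of_forall fun x => ?_)
  simp only [hci]
  change (((Complex.ofReal ∘ θ) x) • FunctionSpaces.EuclideanSpace.complexify (w x)) i = _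
  simp [Complex.ofReal_mul]

/-- **Pairings of the represented real fields converge**: if `gₙ ⇀ g` weakly in
`Ḣ^{1/2}(ℝ³; ℂ³)`, `gₙ` represents the real field `uₙ` and `g` represents the real field `v`,
then `∫ θ (uₙ)ᵢ → ∫ θ vᵢ` for every real test function `θ` and every component `i`
(`Represents.tendsto_inner_integral_smul` with `c = eᵢ`). Rusin–Šverák 2011, proof of Cor. 4.3.
[cite: RusinSverak2011, proof of Cor. 4.3 (arXiv:0911.0500 p. 8)] -/
theorem _root_.Literature.Analysis.FunctionSpaces.HomSobolev.Represents.tendsto_integral_mul_apply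
    {gseq : ℕ → HomSobolev (EuclideanSpace ℝ (Fin 3)) (EuclideanSpace ℂ (Fin 3)) (1 / 2 : ℝ)}
    {glim : HomSobolev (EuclideanSpace ℝ (Fin 3)) (EuclideanSpace ℂ (Fin 3)) (1 / 2 : ℝ)}
    (hw : ∀ w : HomSobolev (EuclideanSpace ℝ (Fin 3)) (EuclideanSpace ℂ (Fin 3)) (1 / 2 : ℝ),
      Tendsto (fun n => ⟪gseq n, w⟫_ℂ) atTop (𝓝 ⟪glim, w⟫_ℂ))
    {u : ℕ → EuclideanSpace ℝ (Fin 3) → EuclideanSpace ℝ (Fin 3)}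
    (hseq : ∀ n, (gseq n).Represents (FunctionSpaces.EuclideanSpace.complexify ∘ u n))
    {v : EuclideanSpace ℝ (Fin 3) → EuclideanSpace ℝ (Fin 3)}
    (hlim : glim.Represents (FunctionSpaces.EuclideanSpace.complexify ∘ v))
    {θ : EuclideanSpace ℝ (Fin 3) → ℝ} (hθ : ContDiff ℝ ((⊤ : ℕ∞) : WithTop ℕ∞) θ)
    (hθc : HasCompactSupport θ) (i : Fin 3) :
    Tendsto (fun n => ∫ x, θ x * u n x i) atTop (𝓝 (∫ x, θ x * v x i)) := by
  set ψ : 𝓢(EuclideanSpace ℝ (Fin 3), ℂ) :=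
    (hasCompactSupport_ofReal_comp hθc).toSchwartzMap (contDiff_ofReal_comp hθ) with hψ_def
  set φ : 𝓢(EuclideanSpace ℝ (Fin 3), ℂ) := 𝓕⁻ ψ with hφ_def
  have hφ : 𝓕 φ = ψ := fourier_fourierInv_eq ψ
  have hint : ∀ w : EuclideanSpace ℝ (Fin 3) → EuclideanSpace ℝ (Fin 3),
      (∀ g : HomSobolev (EuclideanSpace ℝ (Fin 3)) (EuclideanSpace ℂ (Fin 3)) (1 / 2 : ℝ),
        g.Represents (FunctionSpaces.EuclideanSpace.complexify ∘ w) →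
        Integrable (fun x => ψ x • FunctionSpaces.EuclideanSpace.complexify (w x)) volume) := fun w g hg => by
    have := hg.1 φ
    rwa [hφ] at this
  have h := Represents.tendsto_inner_integral_smul hw hseq hlim ψ (EuclideanSpace.single i (1 : ℂ))
  have h1 : ∀ n, ⟪EuclideanSpace.single i (1 : ℂ), ∫ x, ψ x • (FunctionSpaces.EuclideanSpace.complexify ∘ u n) x⟫_ℂ
      = ((∫ x, θ x * u n x i : ℝ) : ℂ) := fun n =>
    inner_single_integral_smul_complexify hθ hθc (u n) (hint (u n) (gseq n) (hseq n)) i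
  have h2 : ⟪EuclideanSpace.single i (1 : ℂ), ∫ x, ψ x • (FunctionSpaces.EuclideanSpace.complexify ∘ v) x⟫_ℂ
      = ((∫ x, θ x * v x i : ℝ) : ℂ) :=
    inner_single_integral_smul_complexify hθ hθc v (hint v glim hlim) i
  simp only [h1, h2] at h
  have h3 := (Complex.continuous_re.tendsto _).comp h
  simpa only [Function.comp_def, Complex.ofReal_re] using h3

/-- **Weak limits of classes representing real fields represent a.e.-real functions.** If
`gₙ ⇀ g` weakly in `Ḣ^{1/2}(ℝ³; ℂ³)`, each `gₙ` represents a real field `complexify ∘ uₙ`, and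
`g` represents a locally integrable `f : ℝ³ → ℂ³`, then every component of `f` has a.e.
vanishing imaginary part: `∫ θ Im fᵢ = lim Im ∫ θ (uₙ)ᵢ = 0` for all real test functions `θ`
(Mathlib `ae_eq_zero_of_integral_contDiff_smul_eq_zero`). Rusin–Šverák 2011, proof of
Cor. 4.3 (the weak limit `v₀` of the real data `v₀^k` is an initial datum).
[cite: RusinSverak2011, proof of Cor. 4.3 (arXiv:0911.0500 p. 8)] -/
theorem _root_.Literature.Analysis.FunctionSpaces.HomSobolev.Represents.im_apply_ae_eq_zero
    {gseq : ℕ → HomSobolev (EuclideanSpace ℝ (Fin 3)) (EuclideanSpace ℂ (Fin 3)) (1 / 2 : ℝ)}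
    {glim : HomSobolev (EuclideanSpace ℝ (Fin 3)) (EuclideanSpace ℂ (Fin 3)) (1 / 2 : ℝ)}
    (hw : ∀ w : HomSobolev (EuclideanSpace ℝ (Fin 3)) (EuclideanSpace ℂ (Fin 3)) (1 / 2 : ℝ),
      Tendsto (fun n => ⟪gseq n, w⟫_ℂ) atTop (𝓝 ⟪glim, w⟫_ℂ))
    {u : ℕ → EuclideanSpace ℝ (Fin 3) → EuclideanSpace ℝ (Fin 3)}
    (hseq : ∀ n, (gseq n).Represents (FunctionSpaces.EuclideanSpace.complexify ∘ u n))
    {f : EuclideanSpace ℝ (Fin 3) → EuclideanSpace ℂ (Fin 3)} (hlim : glim.Represents f)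
    (hf : LocallyIntegrable f volume) (i : Fin 3) :
    (fun x => (f x i).im) =ᵐ[volume] (0 : EuclideanSpace ℝ (Fin 3) → ℝ) := by
  -- the component functional `v ↦ Im (v i)` is a continuous `ℝ`-linear map
  set Li : EuclideanSpace ℂ (Fin 3) →L[ℝ] ℝ :=
    Complex.imCLM.comp ((EuclideanSpace.proj (𝕜 := ℂ) i).restrictScalars ℝ) with hLi_def
  have hLi : ∀ v, Li v = (v i).im := fun v => rfl
  have hfi : LocallyIntegrable (fun x => (f x i).im) volume := by
    have : LocallyIntegrable (Li ∘ f) volume := fun x => by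
      obtain ⟨U, hU, hint⟩ := hf x
      exact ⟨U, hU, Li.integrable_comp hint⟩
    simpa only [Function.comp_def, hLi] using this
  refine ae_eq_zero_of_integral_contDiff_smul_eq_zero hfi fun θ hθ hθc => ?_
  set ψ : 𝓢(EuclideanSpace ℝ (Fin 3), ℂ) :=
    (hasCompactSupport_ofReal_comp hθc).toSchwartzMap (contDiff_ofReal_comp hθ) with hψ_def
  set φ : 𝓢(EuclideanSpace ℝ (Fin 3), ℂ) := 𝓕⁻ ψ with hφ_def
  have hφ : 𝓕 φ = ψ := fourier_fourierInv_eq ψ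
  -- the pairings `∫ θ (uₙ)ᵢ` are real and converge to `(∫ ψ • f)ᵢ`
  have h := Represents.tendsto_inner_integral_smul hw hseq hlim ψ (EuclideanSpace.single i (1 : ℂ))
  have h1 : ∀ n, ⟪EuclideanSpace.single i (1 : ℂ), ∫ x, ψ x • (FunctionSpaces.EuclideanSpace.complexify ∘ u n) x⟫_ℂ
      = ((∫ x, θ x * u n x i : ℝ) : ℂ) := fun n => by
    have hint : Integrable (fun x => ψ x • FunctionSpaces.EuclideanSpace.complexify (u n x)) volume := by
      have := (hseq n).1 φ
      rwa [hφ] at this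
    exact inner_single_integral_smul_complexify hθ hθc (u n) hint i
  have hintf : Integrable (fun x => ψ x • f x) volume := by
    have := hlim.1 φ
    rwa [hφ] at this
  have hci : ∀ v : EuclideanSpace ℂ (Fin 3), (EuclideanSpace.proj (𝕜 := ℂ) i) v = v i :=
    fun v => rfl
  have h2 : ⟪EuclideanSpace.single i (1 : ℂ), ∫ x, ψ x • f x⟫_ℂ = ∫ x, (θ x : ℂ) * f x i := by
    rw [EuclideanSpace.inner_single_left, map_one, one_mul]
    change (EuclideanSpace.proj (𝕜 := ℂ) i) (∫ x, _ ) = _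
    rw [← ContinuousLinearMap.integral_comp_comm _ hintf]
    refine integral_congr_ae (Eventually.of_forall fun x => ?_)
    simp only [hci]
    rfl
  simp only [h1, h2] at h
  -- hence the imaginary part of the limit vanishes
  have h3 : Tendsto (fun n : ℕ => (0 : ℝ)) atTop (𝓝 (∫ x, (θ x : ℂ) * f x i).im) := by
    have := (Complex.continuous_im.tendsto _).comp h
    simpa only [Function.comp_def, Complex.ofReal_im] using this
  have h4 : (∫ x, (θ x : ℂ) * f x i).im = 0 := tendsto_nhds_unique h3 tendsto_const_nhds
  have hint' : Integrable (fun x => (θ x : ℂ) * f x i) volume := by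
    have := (EuclideanSpace.proj (𝕜 := ℂ) i).integrable_comp hintf
    refine this.congr (Eventually.of_forall fun x => ?_)
    simp only [hci]
    rfl
  have h5 : (∫ x, (θ x : ℂ) * f x i).im = ∫ x, θ x * (f x i).im := by
    have him := integral_im hint'
    rw [show (∫ x, (θ x : ℂ) * f x i).im = RCLike.im (∫ x, (θ x : ℂ) * f x i) from rfl, ← him]
    refine integral_congr_ae (Eventually.of_forall fun x => ?_)
    show RCLike.im ((θ x : ℂ) * f x i) = θ x * (f x i).im
    simp
  have h6 : ∫ x, θ x * (f x i).im = 0 := by rw [← h5, h4]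
  simpa only [smul_eq_mul] using h6

/-- **`∫ ⟪w, ∇θ⟫ = Σᵢ ∫ ∂ᵢθ wᵢ`** for a locally integrable field `w` and a test function `θ`
(expand `w(x)` in the standard basis; each `∂ᵢθ wᵢ` is integrable). [folklore] -/
theorem _root_.Literature.Analysis.FunctionSpaces.HomSobolev.integral_inner_gradient_eq_sum {w : EuclideanSpace ℝ (Fin 3) → EuclideanSpace ℝ (Fin 3)}
    (hw : LocallyIntegrable w volume) {θ : EuclideanSpace ℝ (Fin 3) → ℝ}
    (hθ : ContDiff ℝ ((⊤ : ℕ∞) : WithTop ℕ∞) θ) (hθc : HasCompactSupport θ) :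
    ∫ x, ⟪w x, gradient θ x⟫_ℝ =
      ∑ i, ∫ x, fderiv ℝ θ x (EuclideanSpace.basisFun (Fin 3) ℝ i) * w x i := by
  have hpt : ∀ x, ⟪w x, gradient θ x⟫_ℝ =
      ∑ i, fderiv ℝ θ x (EuclideanSpace.basisFun (Fin 3) ℝ i) * w x i := fun x => by
    rw [FluidPDE.real_inner_gradient_right]
    conv_lhs => rw [← (EuclideanSpace.basisFun (Fin 3) ℝ).sum_repr (w x)]
    simp [map_sum, map_smul, mul_comm]
  simp_rw [hpt]
  refine integral_finsetSum _ fun i _ => ?_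
  have hdi : Continuous fun x => fderiv ℝ θ x (EuclideanSpace.basisFun (Fin 3) ℝ i) :=
    (hθ.continuous_fderiv (by simp)).clm_apply continuous_const
  have hsi : HasCompactSupport fun x => fderiv ℝ θ x (EuclideanSpace.basisFun (Fin 3) ℝ i) :=
    hθc.fderiv_apply (𝕜 := ℝ) _
  have h1 := hw.integrable_smul_left_of_hasCompactSupport hdi hsi
  have h2 := (EuclideanSpace.proj (𝕜 := ℝ) i).integrable_comp h1
  refine h2.congr (Eventually.of_forall fun x => ?_)
  rfl

/-- Partial derivatives of test functions are test functions. [folklore] -/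
theorem _root_.Literature.Analysis.FunctionSpaces.HomSobolev.contDiff_fderiv_apply_of_contDiff {θ : EuclideanSpace ℝ (Fin 3) → ℝ}
    (hθ : ContDiff ℝ ((⊤ : ℕ∞) : WithTop ℕ∞) θ) (e : EuclideanSpace ℝ (Fin 3)) :
    ContDiff ℝ ((⊤ : ℕ∞) : WithTop ℕ∞) fun x => fderiv ℝ θ x e :=
  (contDiff_infty_iff_fderiv.1 hθ).2.clm_apply contDiff_const

/-- **Weak `Ḣ^{1/2}` limits of real, weakly divergence-free data are real, weakly
divergence-free data.** Let `gₙ ⇀ g` weakly in `Ḣ^{1/2}(ℝ³; ℂ³)`, where `gₙ` represents the real,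
locally integrable, weakly divergence-free field `uₙ` (`complexify ∘ uₙ`), and suppose `g`
represents some `f ∈ L³(ℝ³; ℂ³)`. Then `f` is a.e. equal to `complexify ∘ v` for a weakly
divergence-free `v ∈ L³(ℝ³; ℝ³)`, which `g` represents: reality by
`Represents.im_apply_ae_eq_zero`, and `∫ ⟪v, ∇θ⟫ = Σᵢ ∫ ∂ᵢθ vᵢ = lim Σᵢ ∫ ∂ᵢθ (uₙ)ᵢ = lim ∫ ⟪uₙ, ∇θ⟫ = 0`
by `Represents.tendsto_integral_mul_apply`. This is the (tacit) step "`v₀ ∈ Ḣ^{1/2}` is again an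
initial datum" in Rusin–Šverák 2011, proof of Cor. 4.3 (p. 8) / Thm. 4.2 (p. 7), for the tree's
transcription of data as represented real divergence-free `L³` fields.
[cite: RusinSverak2011, proof of Cor. 4.3 (arXiv:0911.0500 p. 8)] -/
theorem _root_.Literature.Analysis.FunctionSpaces.HomSobolev.Represents.exists_real_divFree
    {gseq : ℕ → HomSobolev (EuclideanSpace ℝ (Fin 3)) (EuclideanSpace ℂ (Fin 3)) (1 / 2 : ℝ)}
    {glim : HomSobolev (EuclideanSpace ℝ (Fin 3)) (EuclideanSpace ℂ (Fin 3)) (1 / 2 : ℝ)}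
    (hw : ∀ w : HomSobolev (EuclideanSpace ℝ (Fin 3)) (EuclideanSpace ℂ (Fin 3)) (1 / 2 : ℝ),
      Tendsto (fun n => ⟪gseq n, w⟫_ℂ) atTop (𝓝 ⟪glim, w⟫_ℂ))
    {u : ℕ → EuclideanSpace ℝ (Fin 3) → EuclideanSpace ℝ (Fin 3)}
    (hseq : ∀ n, (gseq n).Represents (FunctionSpaces.EuclideanSpace.complexify ∘ u n))
    (hu : ∀ n, LocallyIntegrable (u n) volume) (hdiv : ∀ n, FluidPDE.IsWeaklyDivFree (u n))
    {f : EuclideanSpace ℝ (Fin 3) → EuclideanSpace ℂ (Fin 3)} (hlim : glim.Represents f)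
    (hf3 : MemLp f 3 volume) :
    ∃ v : EuclideanSpace ℝ (Fin 3) → EuclideanSpace ℝ (Fin 3), MemLp v 3 volume ∧
      glim.Represents (FunctionSpaces.EuclideanSpace.complexify ∘ v) ∧ FluidPDE.IsWeaklyDivFree v ∧
      (FunctionSpaces.EuclideanSpace.complexify ∘ v) =ᵐ[volume] f := by
  have hfloc : LocallyIntegrable f volume := hf3.locallyIntegrable (by norm_num)
  have him : ∀ i, (fun x => (f x i).im) =ᵐ[volume] (0 : EuclideanSpace ℝ (Fin 3) → ℝ) :=
    fun i => Represents.im_apply_ae_eq_zero hw hseq hlim hfloc i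
  -- the real part of `f`
  set R : EuclideanSpace ℂ (Fin 3) → EuclideanSpace ℝ (Fin 3) :=
    fun z => WithLp.toLp 2 fun i => (z i).re with hR_def
  have hRc : Continuous R :=
    (PiLp.continuous_toLp 2 _).comp
      (continuous_pi fun i => Complex.continuous_re.comp (EuclideanSpace.proj (𝕜 := ℂ) i).continuous)
  set v : EuclideanSpace ℝ (Fin 3) → EuclideanSpace ℝ (Fin 3) := fun x => R (f x) with hv_def
  have hae : (FunctionSpaces.EuclideanSpace.complexify ∘ v) =ᵐ[volume] f := by
    have hall : ∀ᵐ x ∂(volume : Measure (EuclideanSpace ℝ (Fin 3))), ∀ i, (f x i).im = 0 :=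
      ae_all_iff.2 fun i => (him i).mono fun x hx => hx
    filter_upwards [hall] with x hx
    ext i
    have h1 : (FunctionSpaces.EuclideanSpace.complexify (v x)) i = (((f x i).re : ℝ) : ℂ) := by
      simp [hv_def, hR_def]
    rw [Function.comp_apply, h1]
    exact Complex.ext (by simp) (by simp [hx i])
  have hv3 : MemLp v 3 volume := by
    refine MemLp.of_le hf3 (hRc.comp_aestronglyMeasurable hf3.1) ?_
    filter_upwards [hae] with x hx
    rw [← FunctionSpaces.EuclideanSpace.norm_complexify (v x)]
    exact le_of_eq (congrArg _ hx)
  have hrep : glim.Represents (FunctionSpaces.EuclideanSpace.complexify ∘ v) := hlim.congr_ae hae.symm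
  refine ⟨v, hv3, hrep, fun θ hθ => ?_, hae⟩
  -- divergence-freeness passes to the limit
  have hvloc : LocallyIntegrable v volume := hv3.locallyIntegrable (by norm_num)
  rw [integral_inner_gradient_eq_sum hvloc hθ.contDiff hθ.hasCompactSupport]
  have hlimit : Tendsto (fun n => ∑ i, ∫ x, fderiv ℝ θ x (EuclideanSpace.basisFun (Fin 3) ℝ i) * u n x i)
      atTop (𝓝 (∑ i, ∫ x, fderiv ℝ θ x (EuclideanSpace.basisFun (Fin 3) ℝ i) * v x i)) :=
    tendsto_finsetSum _ fun i _ =>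
      Represents.tendsto_integral_mul_apply hw hseq hrep
        (contDiff_fderiv_apply_of_contDiff hθ.contDiff _) (hθ.hasCompactSupport.fderiv_apply (𝕜 := ℝ) _) i
  have hzero : ∀ n, ∑ i, ∫ x, fderiv ℝ θ x (EuclideanSpace.basisFun (Fin 3) ℝ i) * u n x i = 0 :=
    fun n => by
    rw [← integral_inner_gradient_eq_sum (hu n) hθ.contDiff hθ.hasCompactSupport]
    exact hdiv n θ hθ
  simp only [hzero] at hlimit
  exact tendsto_nhds_unique tendsto_const_nhds hlimit ▸ rfl

end Real

end HomSobolev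

end Literature.Analysis.FluidPDE
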